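import Literature.MathematicalPhysics.QuantumFieldTheory.BalabanImbrieJaffe1984to88.BIJ88ScalarTranslation330Torus
import Literature.MathematicalPhysics.QuantumFieldTheory.BalabanImbrieJaffe1984to88.BIJ88DeltaLocULocalityTorus

/-!
# `BalabanImbrieJaffe1984to88.BIJ88ScalarTranslation330Locality` — T. Bałaban, J. Imbrie, A. Jaffe, *Effective action and cluster properties of
the abelian Higgs model*, Commun. Math. Phys. **114** (1988) 257–315 [BalabanImbrieJaffe1988], Sect. 2 p. 264 [PDF 8] with Sect. 3 p. 270
[PDF 14]: **THE `u`-LOCALITY CLAUSE OF (2.43) FOR THE FIRST-STEP KERNEL AND FOR THE (3.30) CORRECTION** — *"The local part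
C^{(k)}_{Λ,loc}(u; x₁, x₂) depends only on u in an O(r(e_k)) neighborhood of x₁, x₂"* PROVED for the companion's complex kernel
`cLocC Λ (nOp κ c u 1 univ) M ρ` of `C^{(0)}_{Λ,loc}(u₁)` (the first-step operator `−Δ_{u₁} + aL^{−2}Q(u₁)*Q(u₁)`), and hence for the composed
correction `corr330` of (3.30) (*"Again we make a local translation"*): two bond fields that agree on the bonds inside the `L`-blocks of the sites of
`Λ` within chart distance `(ρ+1)M` of `x₁` and of `x₂` (resp. `(2ρ+1)M` of `x`) give the same `C^{(0)}_{Λ,loc}(x₁,x₂)` (resp. the same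
`(C^{(0)}_{Λ,loc}Q*ψ)(x)`) — p13's termwise `BIJ88Locality246Lattice.cLoc_congr_local` through p31's chart dictionary `agreeOn_reOp`, with the
entrywise `u`-dependence of `−Δ_u` (one bond) and of `Q(u)*Q(u)` (p31's `pOp_apply_congr`: the bonds of two `L`-blocks) made explicit.

statement-level skeleton of published theorems with citation tags; proofs where landed; nothing here is a claim about the Yang–Mills mass gap

PDF held: `paper:balaban1988-cmp114-bij-abelian-higgs-effective-action` (journal page = PDF page + 256); p. 264 [PDF 8] re-read this session from the
text layer.

CITATION HEADER (lean-in-tree rule).  Part of the lit-balaban TYPED SKELETON (HOME `run/shared/lean/pub/lit-balaban/`), PHASE-2 proof seat p29 gen 34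
(unit `lit-balaban-p29`; TAKING line HOME/STATUS.md 2026-08-23T12:41Z, free-target protocol G.5-34(d)).  Rows served (cells; owner r18): **C2.Eq2.43**
(the *"depends only on u"* clause for the first-step operator — the general-step instance is p31's `BIJ88DeltaLocULocalityTorus.cLoc_congr_bonds`),
**C2.Eq3.30** (locality of the composed correction: *"local translation"*).  Theorems only; no definition, no `Prop`-valued fact.

THE PRINTED TEXT (verbatim, p. 264 [PDF 8]).  *"We define the localized form of C^{(k)}_Λ(u) to be C^{(k)}_{Λ,loc}(u; x₁, x₂) = Σ′_ω C^{(k)}_{Λ,ω}(x₁, x₂),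
(2.43) where the prime indicates that only ω remaining within ¼r(e_k) of x₁, x₂ are included. … The local part C^{(k)}_{Λ,loc}(u; x₁, x₂) depends only
on u in an O(r(e_k)) neighborhood of x₁, x₂; it vanishes for |x₁ − x₂| > ½r(e_k) and is bounded as in (2.41)."*  p. 270 [PDF 14]: *"Again we make a
local translation, φ = φ^{(0)} + aL^{−2}Λ₇^{(0)}C^{(0)}_{loc}(u₁)Q*(u₁)ψ. (3.30)"*.

WHAT IS PROVED (kernel-checked, 0 `sorry`).
* §1 ENTRYWISE `u`-DEPENDENCE OF THE FIRST-STEP OPERATOR: `dN_univ_apply_of_ne_src` / `_of_ne_tgt`, **`lapU_apply_congr`** (`(−Δ_u)(y₁,y₂)` sees only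
  the bond joining `y₁, y₂` — the diagonal `2dc²` is field-free since `|u(b)| = 1`), **`nOp_univ_apply_congr`** (`(−Δ_u + κQ(u)*Q(u))(y₁,y₂)` sees only
  the bonds inside `{y₁,y₂} ∪ B(y₁) ∪ B(y₂)` — p31's `pOp_apply_congr` for the `Q*Q` part).
* §2 `agreeOn_reOp_nOp_univ`, **`cLocC_nOp_univ_congr`** — THE PRINTED CLAUSE for `C^{(0)}_{Λ,loc}(u₁)`: for cubes `M ≥ 1` and radius `ρ`, if
  `u = u′` on the bonds inside a set `S ⊇ ⋃ {B(y) : y ∈ Λ, |y − x₁|_chart ≤ (ρ+1)M, |y − x₂|_chart ≤ (ρ+1)M}` then `C^{(0)}_{Λ,loc}(u; x₁, x₂) =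
  C^{(0)}_{Λ,loc}(u′; x₁, x₂)` (both real coordinates: p13's `cLoc_congr_local` BY NAME on p31's `agreeOn_reOp`).
* §3 **`qstar_mulVec_congr`** (`(Q(u)ᴴψ)(x)` sees only the bonds of `B(x)`), **`corr330_congr`** — the (3.30) correction `(C^{(0)}_{Λ,loc}(u₁)Q(u₁)*ψ)(x)`
  depends on `u₁` only through the bonds inside any `S ⊇ ⋃ {B(y) : y ∈ Λ, |y − x|_chart ≤ (2ρ+1)M}` (the columns beyond `2ρM` vanish by the companion's
  `corr330_eq_sum_filter`; `(ρ+1)M, 2ρM ≤ (2ρ+1)M`).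
HONEST SCOPE.  (i) Termwise statements (no smallness of `u`, any `κ, c, ρ`, `M ≥ 1`), as p13's / p31's.  (ii) The neighbourhoods are stated in the CHART
sup-distance of p31's `BIJ88Eq242HiggsCovarianceTorus.cdist` with explicit radii `(ρ+1)M` / `(2ρ+1)M` (print: `O(r(e_k))`, `ρM = ¼r(e_k)`); `B(y)` =
the `L`-block of the block-lattice site over `y` (`block (blockOf y)`), whose bonds carry the transporters of `Q(u)`.  (iii) Nothing on sizes (companion
`BIJ88ScalarTranslation330Size`) or on (3.33).  Imports the companion `BIJ88ScalarTranslation330Torus` and p31's `BIJ88DeltaLocULocalityTorus`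
(`BondAgree`, `agreeOn_reOp`, `pOp_apply_congr`, `holC_congr`); Literature only; NOT summit progress; NOT continuum; NOT Clay.
-/

open scoped BigOperators Matrix ComplexConjugate
open Finset Matrix

namespace Literature.MathematicalPhysics.QuantumFieldTheory.BalabanImbrieJaffe1984to88.BIJ88ScalarTranslation330Locality

open Literature.MathematicalPhysics.QuantumFieldTheory.Balaban1983to89
open BIJ88Sect3Statements (U1 toC cfg starB mem_starB norm_toC)
open BIJ85BlockAveragesTorus BIJ85BlockAveragesTorusK
open BIJ88NeumannPropagator227Torus (nOp dN conj_mul_toC)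
open BIJ88NeumannPropagatorFlatDecay (dN_univ_apply)
open BIJ88DeltaLoc234Torus (qMatT qMatT_apply)
open BIJ88Eq240FlatTorus (op240 pOp)
open BIJ88RandomWalk242 BIJ88Eq242Lattice BIJ88Ineq246Lattice B4Sect5CubeBounds
open BIJ88Locality246Lattice (AgreeOn nbhd mem_nbhd cLoc_congr_local)
open BIJ88Eq242HiggsCovarianceTorus
open BIJ88DeltaLocULocalityTorus (BondAgree agreeOn_reOp pOp_apply_congr holC_congr)
open BIJ88ScalarTranslation330Torus

noncomputable section

variable {P : Params} {j : ℕ}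

/-! ## §1  Entrywise `u`-dependence of `−Δ_u` and of the first-step operator -/

section Entry

variable {c : ℝ} {U U' : GaugeField P j U1}

/-- kernel: away from `b₋` an entry of `D_u` is `c·u(b)·𝟙[x = b₊]`. [cite: BalabanImbrieJaffe1988, (3.3) p.265] -/
theorem dN_univ_apply_of_ne_src (c : ℝ) (U : GaugeField P j U1) {b : PBond P j} {x : Balaban1983to89.Site P j} (hx : x ≠ b.src) :
    dN c U univ b x = (c : ℂ) * (if x = b.tgt then cfg U b else 0) := by
  rw [dN_univ_apply, if_neg hx, mul_zero, sub_zero]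

/-- kernel: away from `b₊` an entry of `D_u` is `−c·𝟙[x = b₋]` (field-free). [cite: BalabanImbrieJaffe1988, (3.3) p.265] -/
theorem dN_univ_apply_of_ne_tgt (c : ℝ) (U : GaugeField P j U1) {b : PBond P j} {x : Balaban1983to89.Site P j} (hx : x ≠ b.tgt) :
    dN c U univ b x = -((c : ℂ) * (if x = b.src then 1 else 0)) := by
  rw [dN_univ_apply, if_neg hx, mul_zero, zero_sub]

/-- kernel: `conj(u(b))·u(b) = 1`. [cite: BalabanImbrieJaffe1988, (3.3) p.265] -/
private theorem conj_cfg_mul_cfg (U : GaugeField P j U1) (b : PBond P j) : (starRingEnd ℂ) (cfg U b) * cfg U b = 1 := conj_mul_toC (U b)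

/-- kernel: the field-free value of a `b₊b₊` product: `conj(c·u(b)𝟙)·(c·u(b)𝟙′) = c²𝟙𝟙′`. [cite: BalabanImbrieJaffe1988, (3.3) p.265] -/
private theorem conj_mul_tgt_tgt (c : ℝ) (U : GaugeField P j U1) (b : PBond P j) (p q : Prop) [Decidable p] [Decidable q] :
    (starRingEnd ℂ) ((c : ℂ) * (if p then cfg U b else 0)) * ((c : ℂ) * (if q then cfg U b else 0)) =
      if p ∧ q then (c : ℂ) * c else 0 := by
  by_cases hp : p
  · by_cases hq : q
    · rw [if_pos hp, if_pos hq, if_pos ⟨hp, hq⟩, map_mul, Complex.conj_ofReal]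
      calc (c : ℂ) * (starRingEnd ℂ) (cfg U b) * ((c : ℂ) * cfg U b) = (c : ℂ) * c * ((starRingEnd ℂ) (cfg U b) * cfg U b) := by ring
        _ = (c : ℂ) * c := by rw [conj_cfg_mul_cfg, mul_one]
    · rw [if_neg hq, if_neg (show ¬(p ∧ q) from fun h => hq h.2), mul_zero, mul_zero]
  · rw [if_neg hp, if_neg (show ¬(p ∧ q) from fun h => hp h.1), mul_zero, map_zero, zero_mul]

/-- **`(−Δ_u)(y₁,y₂)` DEPENDS ON `u` ONLY THROUGH THE BOND JOINING `y₁` AND `y₂`**: two fields that agree on the bonds with both ends in `{y₁, y₂}`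
have the same entry (the diagonal `(−Δ_u)(y,y) = 2dc²` and all other contributions are field-free because `|u(b)| = 1`).
[cite: BalabanImbrieJaffe1988, (2.43) p.264] -/
theorem lapU_apply_congr {y₁ y₂ : Balaban1983to89.Site P j} (h : BondAgree ({y₁, y₂} : Finset (Balaban1983to89.Site P j)) U U') :
    lapU c U y₁ y₂ = lapU c U' y₁ y₂ := by
  rw [BIJ88ScalarTranslation330Torus.lapU, BIJ88ScalarTranslation330Torus.lapU, Matrix.mul_apply, Matrix.mul_apply]
  refine Finset.sum_congr rfl fun b _ => ?_
  rw [conjTranspose_apply, conjTranspose_apply, Complex.star_def]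
  by_cases hs : b.src ∈ ({y₁, y₂} : Finset (Balaban1983to89.Site P j))
  · by_cases ht : b.tgt ∈ ({y₁, y₂} : Finset (Balaban1983to89.Site P j))
    · -- the bond joins the two sites: the fields agree on it
      have hb : U b = U' b := h.apply hs ht
      rw [dN_univ_apply, dN_univ_apply, dN_univ_apply, dN_univ_apply, show cfg U b = cfg U' b by simp only [cfg, hb]]
    · -- `b₊ ∉ {y₁, y₂}`: both entries are the field-free `b₋` values
      have h1 : y₁ ≠ b.tgt := fun e => ht (e ▸ by simp)
      have h2 : y₂ ≠ b.tgt := fun e => ht (e ▸ by simp)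
      rw [dN_univ_apply_of_ne_tgt c U h1, dN_univ_apply_of_ne_tgt c U h2, dN_univ_apply_of_ne_tgt c U' h1, dN_univ_apply_of_ne_tgt c U' h2]
  · -- `b₋ ∉ {y₁, y₂}`: only `b₊` products, field-free by unimodularity
    have h1 : y₁ ≠ b.src := fun e => hs (e ▸ by simp)
    have h2 : y₂ ≠ b.src := fun e => hs (e ▸ by simp)
    rw [dN_univ_apply_of_ne_src c U h1, dN_univ_apply_of_ne_src c U h2, dN_univ_apply_of_ne_src c U' h1, dN_univ_apply_of_ne_src c U' h2,
      conj_mul_tgt_tgt, conj_mul_tgt_tgt]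

/-- **THE FIRST-STEP OPERATOR ENTRY `(−Δ_u + κQ(u)*Q(u))(y₁,y₂)` SEES ONLY THE BONDS INSIDE `{y₁,y₂}` AND THE TWO `L`-BLOCKS `B(y₁)`, `B(y₂)`**
(p31's `pOp_apply_congr` for the `Q*Q` part). [cite: BalabanImbrieJaffe1988, (2.43) p.264] -/
theorem nOp_univ_apply_congr (hj : j + 1 ≤ P.m + P.K) (κ : ℝ) {y₁ y₂ : Balaban1983to89.Site P j}
    (h₁₂ : BondAgree ({y₁, y₂} : Finset (Balaban1983to89.Site P j)) U U') (h₁ : BondAgree (block (blockOf y₁)) U U')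
    (h₂ : BondAgree (block (blockOf y₂)) U U') :
    nOp κ c U 1 univ y₁ y₂ = nOp κ c U' 1 univ y₁ y₂ := by
  rw [nOp_univ_eq_op240, nOp_univ_eq_op240, op240, op240, Matrix.add_apply, Matrix.add_apply, Matrix.smul_apply, Matrix.smul_apply,
    lapU_apply_congr h₁₂, pOp_apply_congr (j := j) (k := 0) hj h₁ h₂]

end Entry

/-! ## §2  (2.43), the `u`-locality clause, for the first-step kernel `C^{(0)}_{Λ,loc}(u₁)` -/

section Kernel

variable {Λ : Finset (Balaban1983to89.Site P j)} {κ c : ℝ} {U U' : GaugeField P j U1} {M : ℕ} {ρ : ℝ}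

/-- kernel: a site of `Λ` charted into p13's neighbourhood `nbhd M ρ p` of a real coordinate `p` over `x ∈ Λ` is within chart distance `(ρ+1)M` of `x`.
[cite: BalabanImbrieJaffe1988, (2.43) p.264] -/
theorem cdist_le_of_chart_mem_nbhd {x : Balaban1983to89.Site P j} (hx : x ∈ Λ) {i : Fin 2} {y : Balaban1983to89.Site P j}
    (hy : chart y ∈ nbhd M ρ (idxEquiv Λ (⟨x, hx⟩, i))) : cdist y x ≤ (ρ + 1) * M := by
  rw [mem_nbhd, coe_idxEquiv_fst] at hy
  simpa only [cdist] using hy.2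

/-- **the charted first-step operators of two fields AGREE on p13's two-point neighbourhood** when the fields agree on the bonds inside a set `S`
containing the `L`-blocks of the sites of `Λ` within chart distance `(ρ+1)M` of `x₁` and of `x₂` (§1 entrywise + p31's `agreeOn_reOp`).
[cite: BalabanImbrieJaffe1988, (2.43) p.264] -/
theorem agreeOn_reOp_nOp_univ (hj : j + 1 ≤ P.m + P.K) {x₁ x₂ : Balaban1983to89.Site P j} (h₁ : x₁ ∈ Λ) (h₂ : x₂ ∈ Λ) (i i' : Fin 2)
    {S : Finset (Balaban1983to89.Site P j)} (hS : ∀ y ∈ Λ, cdist y x₁ ≤ (ρ + 1) * M → cdist y x₂ ≤ (ρ + 1) * M → block (blockOf y) ⊆ S)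
    (h : BondAgree S U U') :
    AgreeOn (nbhd M ρ (idxEquiv Λ (⟨x₁, h₁⟩, i)) ∩ nbhd M ρ (idxEquiv Λ (⟨x₂, h₂⟩, i')))
      (reOp Λ (nOp κ c U 1 univ)) (reOp Λ (nOp κ c U' 1 univ)) := by
  refine agreeOn_reOp fun y₁ hy₁ y₂ hy₂ hc₁ hc₂ => ?_
  rw [Finset.mem_inter] at hc₁ hc₂
  have hB₁ : block (blockOf y₁) ⊆ S := hS y₁ hy₁ (cdist_le_of_chart_mem_nbhd h₁ hc₁.1) (cdist_le_of_chart_mem_nbhd h₂ hc₁.2)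
  have hB₂ : block (blockOf y₂) ⊆ S := hS y₂ hy₂ (cdist_le_of_chart_mem_nbhd h₁ hc₂.1) (cdist_le_of_chart_mem_nbhd h₂ hc₂.2)
  have h12 : ({y₁, y₂} : Finset (Balaban1983to89.Site P j)) ⊆ S := by
    intro z hz
    rw [Finset.mem_insert, Finset.mem_singleton] at hz
    rcases hz with rfl | rfl
    · exact hB₁ (mem_block_iff.2 rfl)
    · exact hB₂ (mem_block_iff.2 rfl)
  exact nOp_univ_apply_congr hj κ (h.mono h12) (h.mono hB₁) (h.mono hB₂)

/-- **(2.43), LOCALITY CLAUSE, FOR THE FIRST-STEP KERNEL** — *"The local part C^{(k)}_{Λ,loc}(u; x₁, x₂) depends only on u in an O(r(e_k)) neighborhood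
of x₁, x₂"*: for cubes `M ≥ 1` and any `ρ, κ, c`, if the bond fields `u, u′` agree on the bonds inside a set `S` containing the `L`-blocks `B(y)` of the
sites `y ∈ Λ` within chart distance `(ρ+1)M` of `x₁` AND of `x₂` (print: `ρM = ¼r(e_k)`), then `C^{(0)}_{Λ,loc}(u; x₁, x₂) = C^{(0)}_{Λ,loc}(u′; x₁, x₂)`
for the complex kernel of the companion (both real coordinates; p13's termwise `cLoc_congr_local` BY NAME).
[cite: BalabanImbrieJaffe1988, (2.43) p.264] -/
theorem cLocC_nOp_univ_congr (hj : j + 1 ≤ P.m + P.K) (hM : 0 < M) (x₁ x₂ : Balaban1983to89.Site P j)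
    {S : Finset (Balaban1983to89.Site P j)} (hS : ∀ y ∈ Λ, cdist y x₁ ≤ (ρ + 1) * M → cdist y x₂ ≤ (ρ + 1) * M → block (blockOf y) ⊆ S)
    (h : BondAgree S U U') :
    cLocC Λ (nOp κ c U 1 univ) M ρ x₁ x₂ = cLocC Λ (nOp κ c U' 1 univ) M ρ x₁ x₂ := by
  by_cases hx₁ : x₁ ∈ Λ
  · by_cases hx₂ : x₂ ∈ Λ
    · rw [cLocC_of_mem hx₁ hx₂, cLocC_of_mem hx₁ hx₂,
        cLoc_congr_local hM ρ _ _ (agreeOn_reOp_nOp_univ (κ := κ) (c := c) hj hx₁ hx₂ 0 0 hS h),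
        cLoc_congr_local hM ρ _ _ (agreeOn_reOp_nOp_univ (κ := κ) (c := c) hj hx₁ hx₂ 1 0 hS h)]
    · rw [cLocC_of_not_mem_right x₁ hx₂, cLocC_of_not_mem_right x₁ hx₂]
  · rw [cLocC_of_not_mem_left hx₁, cLocC_of_not_mem_left hx₁]

end Kernel

/-! ## §3  The (3.30) correction is LOCAL in the background field -/

section Corr

variable {Λ : Finset (Balaban1983to89.Site P j)} {κ c : ℝ} {U U' : GaugeField P j U1} {M : ℕ} {ρ : ℝ}

/-- **`(Q(u)ᴴψ)(x)` sees only the bonds of the `L`-block of `x`** (the transporter `u(Γ_x)` runs inside `B(x)`; p31's `holC_congr`).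
[cite: BalabanImbrieJaffe1985, (4.6.1) p.313] -/
theorem qstar_mulVec_congr (hj : j + 1 ≤ P.m + P.K) (ψ : Balaban1983to89.Site P (j + 1) → ℂ) {x : Balaban1983to89.Site P j}
    (h : BondAgree (block (blockOf x)) U U') : ((qMatT U 1)ᴴ *ᵥ ψ) x = ((qMatT U' 1)ᴴ *ᵥ ψ) x := by
  rw [qstar_mulVec_apply, qstar_mulVec_apply, holCK_one, holCK_one, holC_congr hj h]

/-- **THE (3.30) CORRECTION `(C^{(0)}_{Λ,loc}(u₁)Q(u₁)*ψ)(x)` DEPENDS ON `u₁` ONLY NEAR `x`** (*"Again we make a local translation"*, p. 270; (2.43)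
*"depends only on u in an O(r(e_k)) neighborhood"*): for `M ≥ 1`, `ρ ≥ 0`, if `u₁ = u₁′` on the bonds inside a set `S` containing the `L`-blocks of
the sites of `Λ` within chart distance `(2ρ+1)M` of `x`, the two corrections agree at `x` (columns beyond `2ρM` vanish — the companion's
`corr330_eq_sum_filter`; each remaining column is §2 + `qstar_mulVec_congr`; `(ρ+1)M, 2ρM ≤ (2ρ+1)M`). [cite: BalabanImbrieJaffe1988, (3.30) p.270] -/
theorem corr330_congr (hj : j + 1 ≤ P.m + P.K) (hM : 0 < M) (hρ : 0 ≤ ρ) (ψ : Balaban1983to89.Site P (j + 1) → ℂ)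
    (x : Balaban1983to89.Site P j) {S : Finset (Balaban1983to89.Site P j)}
    (hS : ∀ y ∈ Λ, cdist y x ≤ (2 * ρ + 1) * M → block (blockOf y) ⊆ S) (h : BondAgree S U U') :
    corr330 Λ κ c U M ρ ψ x = corr330 Λ κ c U' M ρ ψ x := by
  have hMpos : (0 : ℝ) < M := by exact_mod_cast hM
  have hρM : (0 : ℝ) ≤ ρ * M := mul_nonneg hρ hMpos.le
  rw [corr330_eq_sum_filter, corr330_eq_sum_filter]
  refine Finset.sum_congr rfl fun x' hx' => ?_
  rw [Finset.mem_filter] at hx'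
  have hnear : cdist x x' ≤ 2 * ρ * M := by
    have := (div_le_iff₀ hMpos).1 hx'.2
    linarith
  by_cases hx'Λ : x' ∈ Λ
  · -- the kernel entry (§2 with the two-point radius `(ρ+1)M ≤ (2ρ+1)M`) and the column (the block of `x′`, `2ρM ≤ (2ρ+1)M`)
    have hS2 : ∀ y ∈ Λ, cdist y x ≤ (ρ + 1) * M → cdist y x' ≤ (ρ + 1) * M → block (blockOf y) ⊆ S :=
      fun y hy hyx _ => hS y hy (by linarith)
    have hcol : block (blockOf x') ⊆ S := hS x' hx'Λ (by rw [cdist_comm]; linarith)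
    rw [cLocC_nOp_univ_congr hj hM x x' hS2 h, qstar_mulVec_congr hj ψ (h.mono hcol)]
  · rw [cLocC_of_not_mem_right x hx'Λ, cLocC_of_not_mem_right x hx'Λ, zero_mul, zero_mul]

end Corr

end

end Literature.MathematicalPhysics.QuantumFieldTheory.BalabanImbrieJaffe1984to88.BIJ88ScalarTranslation330Locality
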